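import Literature.NumberTheory.Automorphic.Liu2021.LemD1AsPrintedIndexedNonVacuityInertRigidity
import Literature.NumberTheory.GaloisRepresentations.HeckeCharacterCofiniteProofs
import Literature.NumberTheory.GaloisRepresentations.FrobeniusDensityTheorem
import Mathlib.NumberTheory.RamificationInertia.Unramified
import Mathlib.RingTheory.RamificationInertia.Ramification
import HarnessLib

/-!
# [Liu2021, App. D §D.1 Step 2 ∕ Lemma D.1 (3)] — INERT WITNESSES EXIST AT ALL BUT FINITELY MANY PLACES; the rigidity of
# `LemD1AsPrintedIndexedNonVacuityInertRigidity` made COFINITE: the CM rows' μ-labels `localMu L (toHeckeCharacter L ψ) v` of any two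
# members of the displayed family coincide at all but finitely many non-split places of `L⁺`

Reproduction ∕ bookkeeping (Literature, THEOREMS ONLY: no definition, no record, no named fact, no `sorry`; nothing is
asserted about Liu's oscillator representations or about the tree's constructed local Weil carriers).

Sequel of `LemD1AsPrintedIndexedNonVacuityInertRigidity.lean`, which carried the INERT WITNESS `π ∈ F_vˣ`, `v_w(ι_w π) = exp(−1)`,
as an explicit hypothesis and named «that inert witnesses exist at all but finitely many non-split places (ramification in `L/L⁺` is
finite)» as NOT formalised.  This file supplies exactly that, in the tree's place model (`PlacesOver E v`, `ι_w = toPlace v w : F_v → E_w`,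
`v_w(ι_w y) = v_v(y)^{e(w|v)}` = tree `valued_toPlace`):

* §1 (any extension `E/F` of number fields) `ramificationIdx'_eq_one_of_isUnramifiedIn`: at a place `v` of `F` unramified in `E`
  (Mathlib `Algebra.IsUnramifiedIn (𝓞 E) v`) every `w ∣ v` has `e(w|v) = 1` (Mathlib `Ideal.ramificationIdx_eq_one_of_isUnramifiedAt`,
  `Ideal.ramificationIdx'_eq_ramificationIdx`), so `ι_w` PRESERVES valuations (`valued_toPlace_of_isUnramifiedIn`) and the tree's chosen
  uniformiser `ϖ_v = HeckeCharacter.uniformizer F v` of `F_v` is an inert witness at EVERY `w ∣ v`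
  (**`valued_toPlace_uniformizer_of_isUnramifiedIn`**); conversely an inert witness at `w` forces `e(w|v) = 1`
  (`ramificationIdx'_eq_one_of_valued_toPlace_eq`: `exp(−1) = v_v(π)^e` only for `e = 1`), so «an inert witness exists at `w`» is
  EQUIVALENT to «`w ∣ v` unramified» (`exists_valued_toPlace_eq_iff_ramificationIdx'_eq_one`).  Since only finitely many places of `F`
  ramify in `E` (tree `finite_setOf_not_isUnramifiedIn` ← Mathlib `dvd_differentIdeal_iff`, `Ideal.finite_factors`):
  **`eventually_forall_valued_toPlace_uniformizer`** — for all but finitely many `v`, `ϖ_v` is an inert witness at every `w ∣ v`;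
  and a Hecke character of `E` is unramified at every `w ∣ v` for all but finitely many `v` (`eventually_forall_placesOver_isUnramifiedAt`
  ← tree `HeckeCharacter.isUnramifiedAt_cofinite_holds`);
* §2 (quadratic `E/F`, the place model with `c ⊗ 1 = conjLocal`) a non-split place unramified in `E` is INERT in the classical sense,
  `f(w|v) = 2` (`inertiaDeg_eq_two_of_smul_eq_of_isUnramifiedIn`: `w` is the only place above `v`, fundamental identity `#{w ∣ v}·e·f = 2`,
  tree `card_placesOver_mul_inertiaDegIn`), hence so at all but finitely many non-split places (`eventually_forall_inertiaDeg_eq_two_of_smul_eq`);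
  and the statements of `…InertRigidity` §1–§2 at ALL BUT FINITELY MANY places `v` of `F`, for every `w ∣ v` fixed by `c`, with the
  witness `ϖ_v`: `ι_v ϖ_v` is NOT a norm from `E_vˣ`
  (`eventually_forall_not_isNorm_uniformizer`); every Step-2 datum `(μ, hμF)` of the rows' displayed shape has `μ(ι_v ϖ_v) = −1`
  (`eventually_forall_stepTwo_apply_uniformizer_eq_neg_one`); two UNRAMIFIED Step-2 data are EQUAL, each being the sign character
  `x ↦ (−1)^{ord_w x_w}` (`eventually_forall_stepTwo_eq_of_unramified`, `eventually_forall_stepTwo_apply_eq_neg_one_zpow`; `MuSet` form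
  `eventually_forall_muSet_eq_of_unramified`);
* §3 (the CM rows: `L` CM, `F = L⁺`, `c` = complex conjugation, the rows' own slot `μ_v = localMu L (toHeckeCharacter L ψ) v` under the
  displayed binder `hψ : IsConjugateSymplectic`): off a finite set of places of `L⁺` every `c`-fixed `w ∣ v` is inert with witness `ϖ_v`
  (`eventually_forall_inertiaDeg_eq_two_and_valued_toPlace_uniformizer`), and, WITHOUT any unramifiedness hypothesis on the characters,
  **`eventually_localMu_eq_localMu`** — for conjugate
  symplectic `ψ, ψ'`, at all but finitely many places `v` of `L⁺`, for every `w ∣ v` fixed by `c`,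
  `localMu L (toHeckeCharacter L ψ) v = localMu L (toHeckeCharacter L ψ') v`; equivalently (**`finite_nonsplit_localMu_ne`**) the NON-SPLIT
  places at which the μ-labels of two members of the displayed `hD3` family DIFFER are FINITE in number (they lie below the ramification
  of `L/L⁺`, of `ψ` and of `ψ'`); the closed form `μ_v(x) = (−1)^{ord_w x_w}` and the value `μ_v(ι_v ϖ_v) = −1` at all but finitely many
  non-split `v` (`eventually_localMu_apply_eq_neg_one_zpow`, `eventually_localMu_apply_uniformizer_eq_neg_one`), and the packaged form
  `eventually_muOf_localMu_eq` (the `LemD1OfPlace.muOf` labels with the rows' displayed side proofs coincide).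

Picture for an auditor of the END rows `hD1''` ∕ `hD3` (our bookkeeping, not a claim about Liu's objects): across the WHOLE displayed family
(members indexed by `ψ`), the `μ`-conjunct of [Lem. D.1 (3)] AS PRINTED can separate two members only at split places and at FINITELY MANY
non-split places of `L⁺`; at every other non-split place all members carry the SAME μ-label, the unramified sign character.

What this does NOT give: the behaviour at the finitely many exceptional non-split places (ramified in `L/L⁺`, or below the ramification of
`ψ`); a second Step-2 character at a prescribed non-split place; anything about the rows' carriers; Lem. D.1 itself.  HC_CM is NOT proved.

Cell pub-hodgecm2 (COR-CM), audit class of the END rows `hD1''` ∕ `hD3`; seat prover-pub-hodgecm2-b10.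

References: [Liu2021] Y. Liu, *Fourier–Jacobi cycles and arithmetic relative trace formula*, Camb. J. Math. 9 (2021) =
arXiv:2102.11518, Def. 4.1, Def. 4.11 (l. 2086), App. D §D.1 Step 2 (l. 5219), Lemma D.1 (3) (l. 5233);
[NeukirchANT1999] J. Neukirch, *Algebraic Number Theory*, Grundlehren 322 (1999), Ch. I §8 Prop. (8.2) (fundamental identity
`Σ eᵢ fᵢ = n`; «nonsplit»), Ch. II §6 (before Prop. (6.8): `v(π) = e·w(Π)`,
`π = ε Π^e`) and §8 (before Prop. (8.5): `e_w = (w(L^*) : v(K^*))`), Ch. III §2 Thm. (2.6) (`𝔓` ramified iff `𝔓 ∣ 𝔇_{L|K}`);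
[TateThesis1967] J. Tate, *Fourier analysis in number fields and Hecke's zeta-functions*, Lemma 3.2.1 (almost all local components
unramified); [CasselsFrohlichANT1967] Ch. II §10 (completions of an extension).
-/

noncomputable section

open scoped Matrix MatrixGroups
open NumberField IsDedekindDomain
open Literature.RepresentationTheory
open Literature.NumberTheory.GaloisRepresentations (HeckeCharacter localUnits)

namespace Literature.NumberTheory.Automorphic.Liu2021.LemD1IndexedNonVacuityInertCofinite

open UnitaryGroup

/-! ## §1 Any extension `E/F` of number fields: `e(w|v) = 1` at the unramified places, inert witnesses, cofiniteness -/

section AnyExtension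

variable {F : Type} (E : Type) [Field F] [NumberField F] [Field E] [NumberField E] [Algebra F E]
  (v : HeightOneSpectrum (𝓞 F))

/-- **at a place `v` of `F` unramified in `E`, every `w ∣ v` has ramification index `e(w|v) = 1`** (the index appearing in the tree's
`valued_toPlace`; Mathlib `Algebra.IsUnramifiedAt ⇒ Ideal.ramificationIdx = 1`, and the two Mathlib ramification indices agree for the
Dedekind extension `𝓞 F → 𝓞 E`). [cite: NeukirchANT1999, Ch. II §6 (before Prop. 6.8) and §8 (before Prop. 8.5)] -/
theorem ramificationIdx'_eq_one_of_isUnramifiedIn (hv : Algebra.IsUnramifiedIn (𝓞 E) v.asIdeal) (w : PlacesOver E v) :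
    v.asIdeal.ramificationIdx' w.1.asIdeal = 1 := by
  haveI : w.1.asIdeal.LiesOver v.asIdeal := PlacesOver.liesOver w
  haveI : Algebra.IsUnramifiedAt (𝓞 F) w.1.asIdeal := hv w.1.asIdeal w.1.isPrime ‹_›
  rw [Ideal.ramificationIdx'_eq_ramificationIdx v.asIdeal w.1.asIdeal v.ne_bot]
  exact Ideal.ramificationIdx_eq_one_of_isUnramifiedAt

/-- **`ι_w : F_v → E_w` preserves the valuation at a place unramified in `E`**: `v_w(ι_w y) = v_v(y)` (`= v_v(y)^{e(w|v)}` with `e = 1`).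
[cite: NeukirchANT1999, Ch. II §6 (before Prop. 6.8) and §8 (before Prop. 8.5)] -/
theorem valued_toPlace_of_isUnramifiedIn (hv : Algebra.IsUnramifiedIn (𝓞 E) v.asIdeal) (w : PlacesOver E v)
    (y : v.adicCompletion F) : Valued.v (toPlace v w y) = Valued.v y := by
  rw [valued_toPlace, ramificationIdx'_eq_one_of_isUnramifiedIn E v hv w, pow_one]

/-- **the chosen uniformiser `ϖ_v` of `F_v` (tree `HeckeCharacter.uniformizer F v`, `v_v(ϖ_v) = exp(−1)`) is an INERT WITNESS at every
`w ∣ v` when `v` is unramified in `E`**: `v_w(ι_w ϖ_v) = exp(−1)` — a uniformiser of `F_v` stays a uniformiser of `E_w` (`π = ε Π^e`, `e = 1`).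
[cite: NeukirchANT1999, Ch. II §6 (before Prop. 6.8)] -/
theorem valued_toPlace_uniformizer_of_isUnramifiedIn (hv : Algebra.IsUnramifiedIn (𝓞 E) v.asIdeal) (w : PlacesOver E v) :
    Valued.v (toPlace v w (HeckeCharacter.uniformizer F v : v.adicCompletion F)) = WithZero.exp (-1 : ℤ) := by
  rw [valued_toPlace_of_isUnramifiedIn E v hv w, HeckeCharacter.valued_uniformizer]

/-- **… so ONE element of `F_vˣ` is an inert witness at every place above an unramified `v` simultaneously.**
[cite: NeukirchANT1999, Ch. II §6 (before Prop. 6.8) and §8 (before Prop. 8.5)] -/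
theorem exists_forall_valued_toPlace_eq_of_isUnramifiedIn (hv : Algebra.IsUnramifiedIn (𝓞 E) v.asIdeal) :
    ∃ π : (v.adicCompletion F)ˣ, ∀ w : PlacesOver E v,
      Valued.v (toPlace v w (π : v.adicCompletion F)) = WithZero.exp (-1 : ℤ) :=
  ⟨HeckeCharacter.uniformizer F v, valued_toPlace_uniformizer_of_isUnramifiedIn E v hv⟩

/-- **conversely, an inert witness at `w` forces `e(w|v) = 1`**: if some `π ∈ F_v` has `v_w(ι_w π) = exp(−1)` then, since
`v_w(ι_w π) = v_v(π)^{e}` with `v_v(π) = exp(m)`, `e · m = −1` and `e = 1`. [cite: NeukirchANT1999, Ch. II §6 (before Prop. 6.8) and §8 (before Prop. 8.5)] -/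
theorem ramificationIdx'_eq_one_of_valued_toPlace_eq (w : PlacesOver E v) (π : v.adicCompletion F)
    (hπ : Valued.v (toPlace v w π) = WithZero.exp (-1 : ℤ)) : v.asIdeal.ramificationIdx' w.1.asIdeal = 1 := by
  rw [valued_toPlace] at hπ
  set e := v.asIdeal.ramificationIdx' w.1.asIdeal with he
  have hπ0 : Valued.v π ≠ 0 := by
    intro h0
    rw [h0] at hπ
    rcases Nat.eq_zero_or_pos e with he0 | he0
    · rw [he0, pow_zero] at hπ
      exact (neg_ne_zero.2 one_ne_zero) (WithZero.exp_inj.1 (WithZero.exp_zero.trans hπ)).symm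
    · rw [zero_pow he0.ne'] at hπ
      exact WithZero.exp_ne_zero hπ.symm
  rw [← WithZero.exp_log hπ0, ← WithZero.exp_nsmul, WithZero.exp_inj, nsmul_eq_mul] at hπ
  have h := congrArg Int.natAbs hπ
  rw [Int.natAbs_mul, Int.natAbs_neg, Int.natAbs_one, Int.natAbs_natCast] at h
  exact Nat.eq_one_of_mul_eq_one_right h

/-- **«an inert witness exists at `w`» ⟺ «`w ∣ v` is unramified» (`e(w|v) = 1`)** — the hypothesis carried by
`LemD1AsPrintedIndexedNonVacuityInertRigidity` is exactly unramifiedness of `w ∣ v`. [cite: NeukirchANT1999, Ch. II §6 (before Prop. 6.8) and §8 (before Prop. 8.5)] -/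
theorem exists_valued_toPlace_eq_iff_ramificationIdx'_eq_one (w : PlacesOver E v) :
    (∃ π : (v.adicCompletion F)ˣ, Valued.v (toPlace v w (π : v.adicCompletion F)) = WithZero.exp (-1 : ℤ)) ↔
      v.asIdeal.ramificationIdx' w.1.asIdeal = 1 := by
  refine ⟨fun ⟨π, hπ⟩ => ramificationIdx'_eq_one_of_valued_toPlace_eq E v w π hπ, fun h => ⟨HeckeCharacter.uniformizer F v, ?_⟩⟩
  rw [valued_toPlace, h, pow_one, HeckeCharacter.valued_uniformizer]

/-- only finitely many places of `F` ramify in `E` (tree `finite_setOf_not_isUnramifiedIn`: they lie below the prime factors of the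
different), in `∀ᶠ … in cofinite` form. [folklore] -/
private theorem eventually_isUnramifiedIn :
    ∀ᶠ v : HeightOneSpectrum (𝓞 F) in Filter.cofinite, Algebra.IsUnramifiedIn (𝓞 E) v.asIdeal :=
  Filter.eventually_cofinite.2 (GaloisRepresentations.finite_setOf_not_isUnramifiedIn F E)

/-- **INERT WITNESSES EXIST AT ALL BUT FINITELY MANY PLACES**: for all but finitely many finite places `v` of `F`, the uniformiser `ϖ_v`
of `F_v` satisfies `v_w(ι_w ϖ_v) = exp(−1)` at EVERY `w ∣ v` (the exceptions lie below the prime factors of the different `𝔇_{E/F}`).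
[cite: NeukirchANT1999, Ch. III §2 Thm. (2.6)] -/
theorem eventually_forall_valued_toPlace_uniformizer :
    ∀ᶠ v : HeightOneSpectrum (𝓞 F) in Filter.cofinite, ∀ w : PlacesOver E v,
      Valued.v (toPlace v w (HeckeCharacter.uniformizer F v : v.adicCompletion F)) = WithZero.exp (-1 : ℤ) :=
  (eventually_isUnramifiedIn E).mono fun v hv => valued_toPlace_uniformizer_of_isUnramifiedIn E v hv

/-- **… `∃ π ∀ w` form**: for all but finitely many `v` some `π ∈ F_vˣ` is an inert witness at every `w ∣ v`.
[cite: NeukirchANT1999, Ch. III §2 Thm. (2.6)] -/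
theorem eventually_exists_forall_valued_toPlace_eq :
    ∀ᶠ v : HeightOneSpectrum (𝓞 F) in Filter.cofinite, ∃ π : (v.adicCompletion F)ˣ, ∀ w : PlacesOver E v,
      Valued.v (toPlace v w (π : v.adicCompletion F)) = WithZero.exp (-1 : ℤ) :=
  (eventually_isUnramifiedIn E).mono fun v hv => exists_forall_valued_toPlace_eq_of_isUnramifiedIn E v hv

/-- **… and `ι_w` preserves valuations at all but finitely many places**: for all but finitely many `v`, every `w ∣ v` has
`v_w(ι_w y) = v_v(y)` for all `y ∈ F_v` (so `e(w|v) = 1`). [cite: NeukirchANT1999, Ch. III §2 Thm. (2.6)] -/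
theorem eventually_forall_valued_toPlace_eq :
    ∀ᶠ v : HeightOneSpectrum (𝓞 F) in Filter.cofinite, ∀ (w : PlacesOver E v) (y : v.adicCompletion F),
      Valued.v (toPlace v w y) = Valued.v y :=
  (eventually_isUnramifiedIn E).mono fun v hv => valued_toPlace_of_isUnramifiedIn E v hv

omit [NumberField F] in
/-- **a Hecke character of `E` is unramified at EVERY place above `v`, for all but finitely many places `v` of `F`** (it is unramified
outside a finite set of places of `E`, below which lie finitely many places of `F`; tree `HeckeCharacter.isUnramifiedAt_cofinite_holds`).
[cite: TateThesis1967, Lemma 3.2.1] -/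
theorem eventually_forall_placesOver_isUnramifiedAt (χ : HeckeCharacter E) :
    ∀ᶠ v : HeightOneSpectrum (𝓞 F) in Filter.cofinite, ∀ w : PlacesOver E v, χ.IsUnramifiedAt w.1 := by
  have hfin : {w : HeightOneSpectrum (𝓞 E) | ¬ χ.IsUnramifiedAt w}.Finite :=
    Filter.eventually_cofinite.1 (HeckeCharacter.isUnramifiedAt_cofinite_holds χ)
  refine Filter.eventually_cofinite.2 ((hfin.image fun w => w.under (𝓞 F)).subset ?_)
  intro v hv
  rw [Set.mem_setOf_eq, not_forall] at hv
  obtain ⟨w, hw⟩ := hv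
  exact ⟨w.1, hw, w.2⟩

end AnyExtension

/-! ## §2 The quadratic place model: `…InertRigidity` §1–§2 at all but finitely many places, with the witness `ϖ_v` -/

section Quadratic

variable {F : Type} (E : Type) [Field F] [NumberField F] [Field E] [NumberField E] [Algebra F E]
  [Algebra.IsQuadraticExtension F E] (c : E ≃ₐ[F] E) {δ : E} (hcδ : c δ = -δ) (hδ : δ ≠ 0)

/-- **a non-split place unramified in the quadratic extension `E/F` is INERT in the classical sense: `f(w|v) = 2`.**  If `c ≠ 1` fixes
`w ∣ v` then `w` is the ONLY place above `v` (tree `PlacesOver.eq_of_smul_eq`), so the fundamental identity `#{w ∣ v} · e · f = [E : F] = 2`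
(Galois form, tree `card_placesOver_mul_inertiaDegIn` ← Mathlib `Ideal.ncard_primesOver_mul_ramificationIdxIn_mul_inertiaDegIn`) with
`e = 1` (§1) gives `f = 2` — «nonsplit: only a single prime ideal of `L` over `𝔭`».
[cite: NeukirchANT1999, Ch. I §8 Prop. (8.2)] -/
theorem inertiaDeg_eq_two_of_smul_eq_of_isUnramifiedIn (hc : c ≠ 1) (v : HeightOneSpectrum (𝓞 F))
    (hv : Algebra.IsUnramifiedIn (𝓞 E) v.asIdeal) (w : PlacesOver E v) (hw : c • w.1 = w.1) :
    w.1.asIdeal.inertiaDeg (𝓞 F) = 2 := by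
  haveI : w.1.asIdeal.LiesOver v.asIdeal := PlacesOver.liesOver w
  haveI : Algebra.IsUnramifiedAt (𝓞 F) w.1.asIdeal := hv w.1.asIdeal w.1.isPrime ‹_›
  haveI : v.asIdeal.IsMaximal := v.isMaximal
  haveI : IsGaloisGroup (E ≃ₐ[F] E) (𝓞 F) (𝓞 E) := IsGaloisGroup.of_isFractionRing _ _ _ F E
  have hcard : Nat.card (PlacesOver E v) = 1 := by
    rw [Nat.card_eq_one_iff_unique]
    exact ⟨⟨fun a b => (PlacesOver.eq_of_smul_eq c hc w hw a).trans (PlacesOver.eq_of_smul_eq c hc w hw b).symm⟩, ⟨w⟩⟩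
  have hev : v.asIdeal.ramificationIdxIn (𝓞 E) = 1 := by
    rw [Ideal.ramificationIdxIn_eq_ramificationIdx v.asIdeal w.1.asIdeal (E ≃ₐ[F] E)]
    exact Ideal.ramificationIdx_eq_one_of_isUnramifiedAt
  have hfund := card_placesOver_mul_inertiaDegIn (E := E) v hev
  rw [hcard, one_mul, Algebra.IsQuadraticExtension.finrank_eq_two F E] at hfund
  rw [← Ideal.inertiaDegIn_eq_inertiaDeg v.asIdeal w.1.asIdeal (E ≃ₐ[F] E), hfund]

/-- **… so at all but finitely many places `v` of `F`, every `w ∣ v` fixed by `c` has residue degree `f(w|v) = 2`** (and `e(w|v) = 1`, §1):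
off a finite set, «non-split» MEANS «inert». [cite: NeukirchANT1999, Ch. I §8 Prop. (8.2); Ch. III §2 Thm. (2.6)] -/
theorem eventually_forall_inertiaDeg_eq_two_of_smul_eq (hc : c ≠ 1) :
    ∀ᶠ v : HeightOneSpectrum (𝓞 F) in Filter.cofinite, ∀ w : PlacesOver E v, c • w.1 = w.1 →
      w.1.asIdeal.inertiaDeg (𝓞 F) = 2 :=
  (eventually_isUnramifiedIn E).mono fun v hv w hw => inertiaDeg_eq_two_of_smul_eq_of_isUnramifiedIn E c hc v hv w hw

include hcδ hδ in
/-- **at all but finitely many places `v` of `F`: for every `w ∣ v` fixed by `c`, `ι_v ϖ_v` is NOT a norm from `E_vˣ`** (`ϖ_v` the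
uniformiser of `F_v`; `…InertRigidity.not_isNorm_of_valued_eq` with the inert witness of §1). [cite: Liu2021, App. D §D.1 Step 2 (l. 5219)]
[cite: NeukirchANT1999, Ch. III §2 Thm. (2.6)] -/
theorem eventually_forall_not_isNorm_uniformizer :
    ∀ᶠ v : HeightOneSpectrum (𝓞 F) in Filter.cofinite, ∀ w : PlacesOver E v, c • w.1 = w.1 →
      ¬ ∃ x : (LocalRing E v)ˣ, (x : LocalRing E v) * conjLocal E c v x =
        algebraMap (v.adicCompletion F) (LocalRing E v) (HeckeCharacter.uniformizer F v : v.adicCompletion F) :=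
  (eventually_isUnramifiedIn E).mono fun v hv w hw =>
    LemD1IndexedNonVacuityInertRigidity.not_isNorm_of_valued_eq E v c hcδ hδ w hw (HeckeCharacter.uniformizer F v)
      (valued_toPlace_uniformizer_of_isUnramifiedIn E v hv w)

include hcδ hδ in
/-- **at all but finitely many places `v` of `F`: for every `w ∣ v` fixed by `c`, EVERY Step-2 datum `(μ, hμF)` of the place model (the
rows' displayed binder shape «`μ(ι_v a) = 1 ↔ a ∈ Nm E_vˣ`») takes the value `−1` at `ι_v ϖ_v`.** [cite: Liu2021, App. D §D.1 Step 2 (l. 5219)]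
[cite: NeukirchANT1999, Ch. III §2 Thm. (2.6)] -/
theorem eventually_forall_stepTwo_apply_uniformizer_eq_neg_one :
    ∀ᶠ v : HeightOneSpectrum (𝓞 F) in Filter.cofinite, ∀ w : PlacesOver E v, c • w.1 = w.1 →
      ∀ (μ : (LocalRing E v)ˣ →* ℂˣ),
        (∀ a : (v.adicCompletion F)ˣ,
          μ (Units.map (algebraMap (v.adicCompletion F) (LocalRing E v)).toMonoidHom a) = 1 ↔
            ∃ x : (LocalRing E v)ˣ, (x : LocalRing E v) * conjLocal E c v x =
              algebraMap (v.adicCompletion F) (LocalRing E v) a) →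
        μ (Units.map (algebraMap (v.adicCompletion F) (LocalRing E v)).toMonoidHom (HeckeCharacter.uniformizer F v)) = -1 :=
  (eventually_isUnramifiedIn E).mono fun v hv w hw μ hμF =>
    LemD1IndexedNonVacuityInertRigidity.stepTwo_apply_eq_neg_one_of_valued_eq E v c hcδ hδ w hw (HeckeCharacter.uniformizer F v)
      (valued_toPlace_uniformizer_of_isUnramifiedIn E v hv w) μ hμF

include hcδ hδ in
/-- **RIGIDITY AT ALL BUT FINITELY MANY NON-SPLIT PLACES**: for all but finitely many places `v` of `F`, for every `w ∣ v` fixed by `c`, two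
Step-2 data of the place model which are both UNRAMIFIED (trivial on the units of `w`-valuation `1`) are EQUAL (`…InertRigidity.stepTwo_eq_of_unramified`
with the inert witness `ϖ_v` of §1: at such `v` the printed Step-2 index set has exactly one unramified element).
[cite: Liu2021, App. D §D.1 Step 2 (l. 5219)] [cite: NeukirchANT1999, Ch. III §2 Thm. (2.6)] -/
theorem eventually_forall_stepTwo_eq_of_unramified :
    ∀ᶠ v : HeightOneSpectrum (𝓞 F) in Filter.cofinite, ∀ w : PlacesOver E v, c • w.1 = w.1 →
      ∀ (μ μ' : (LocalRing E v)ˣ →* ℂˣ),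
        (∀ a : (v.adicCompletion F)ˣ,
          μ (Units.map (algebraMap (v.adicCompletion F) (LocalRing E v)).toMonoidHom a) = 1 ↔
            ∃ x : (LocalRing E v)ˣ, (x : LocalRing E v) * conjLocal E c v x =
              algebraMap (v.adicCompletion F) (LocalRing E v) a) →
        (∀ a : (v.adicCompletion F)ˣ,
          μ' (Units.map (algebraMap (v.adicCompletion F) (LocalRing E v)).toMonoidHom a) = 1 ↔
            ∃ x : (LocalRing E v)ˣ, (x : LocalRing E v) * conjLocal E c v x =
              algebraMap (v.adicCompletion F) (LocalRing E v) a) →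
        (∀ u : (LocalRing E v)ˣ, Valued.v ((u : LocalRing E v) w) = 1 → μ u = 1) →
        (∀ u : (LocalRing E v)ˣ, Valued.v ((u : LocalRing E v) w) = 1 → μ' u = 1) → μ = μ' :=
  (eventually_isUnramifiedIn E).mono fun v hv w hw μ μ' hμF hμ'F hμu hμ'u =>
    LemD1IndexedNonVacuityInertRigidity.stepTwo_eq_of_unramified E v c hcδ hδ w hw (HeckeCharacter.uniformizer F v)
      (valued_toPlace_uniformizer_of_isUnramifiedIn E v hv w) μ μ' hμF hμ'F hμu hμ'u

include hcδ hδ in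
/-- **… with the closed form**: for all but finitely many `v`, for every `w ∣ v` fixed by `c`, an unramified Step-2 datum IS the sign
character `x ↦ (−1)^{ord_w x_w}`. [cite: Liu2021, App. D §D.1 Step 2 (l. 5219)] [cite: NeukirchANT1999, Ch. III §2 Thm. (2.6)] -/
theorem eventually_forall_stepTwo_apply_eq_neg_one_zpow :
    ∀ᶠ v : HeightOneSpectrum (𝓞 F) in Filter.cofinite, ∀ w : PlacesOver E v, c • w.1 = w.1 →
      ∀ (μ : (LocalRing E v)ˣ →* ℂˣ),
        (∀ a : (v.adicCompletion F)ˣ,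
          μ (Units.map (algebraMap (v.adicCompletion F) (LocalRing E v)).toMonoidHom a) = 1 ↔
            ∃ x : (LocalRing E v)ˣ, (x : LocalRing E v) * conjLocal E c v x =
              algebraMap (v.adicCompletion F) (LocalRing E v) a) →
        (∀ u : (LocalRing E v)ˣ, Valued.v ((u : LocalRing E v) w) = 1 → μ u = 1) →
        ∀ x : (LocalRing E v)ˣ, μ x = (-1 : ℂˣ) ^ WithZero.log (Valued.v ((x : LocalRing E v) w)) :=
  (eventually_isUnramifiedIn E).mono fun v hv w hw μ hμF hμu =>
    LemD1IndexedNonVacuityInertRigidity.stepTwo_apply_eq_neg_one_zpow E v c hcδ hδ w hw (HeckeCharacter.uniformizer F v)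
      (valued_toPlace_uniformizer_of_isUnramifiedIn E v hv w) μ hμF hμu

variable (N : ℕ) (J : Matrix (Fin N) (Fin N) E) (hN : 2 ≤ N) (hJh : (J.map c)ᵀ = J) (hJdet : J.det ≠ 0)

/-- **`MuSet` form**: for all but finitely many `v`, for every `w ∣ v` fixed by `c`, two unramified elements of the printed Step-2 index set
`LemD1.MuSet (LemD1OfPlace.standingData E v c N J …)` are equal. [cite: Liu2021, App. D §D.1 Step 2 (l. 5219)] [cite: NeukirchANT1999, Ch. III §2 Thm. (2.6)] -/
theorem eventually_forall_muSet_eq_of_unramified :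
    ∀ᶠ v : HeightOneSpectrum (𝓞 F) in Filter.cofinite, ∀ w : PlacesOver E v, c • w.1 = w.1 →
      ∀ μ μ' : LemD1.MuSet (LemD1OfPlace.standingData E v c N J hcδ hδ hN hJh hJdet),
        (∀ u : (LocalRing E v)ˣ, Valued.v ((u : LocalRing E v) w) = 1 → μ.1 u = 1) →
        (∀ u : (LocalRing E v)ˣ, Valued.v ((u : LocalRing E v) w) = 1 → μ'.1 u = 1) → μ = μ' :=
  (eventually_isUnramifiedIn E).mono fun v hv w hw μ μ' hμu hμ'u =>
    LemD1IndexedNonVacuityInertRigidity.muSet_eq_of_unramified E v c hcδ hδ N J hN hJh hJdet w hw (HeckeCharacter.uniformizer F v)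
      (valued_toPlace_uniformizer_of_isUnramifiedIn E v hv w) μ μ' hμu hμ'u

end Quadratic

/-! ## §3 The CM rows: the μ-labels of any two members of the displayed family coincide at all but finitely many non-split places -/

section CM

open Literature.NumberTheory.GelbartRogawski1991.UnitaryDualPair (imagUnit complexConj_imagUnit imagUnit_ne_zero)
open Literature.NumberTheory.GelbartRogawski1991.UnitaryDualPair.LocalSplitting (localMu localMu_apply norm_localMu
  continuous_localMu localMu_toLocalRing_eq_one_iff)
open Literature.NumberTheory.Automorphic.IdeleClassGroup (toHeckeCharacter isUnitary_toHeckeCharacter IsConjugateSymplectic)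
open Literature.RepresentationTheory.Liu2021 (isOscillatorChar_toHeckeCharacter_iff)

variable (L : Type) [Field L] [NumberField L] [IsCMField L]

local notation3 "cc" => (IsCMField.complexConj L)
local notation3 "L⁺" => (↥(maximalRealSubfield L))

/-- **in the CM extension `L/L⁺`: at all but finitely many finite places `v` of `L⁺`, every `w ∣ v` fixed by complex conjugation is INERT
(`f(w|v) = 2`, `e(w|v) = 1`) and the uniformiser `ϖ_v` of `L⁺_v` is an inert witness there (`v_w(ι_w ϖ_v) = exp(−1)`).**
[cite: NeukirchANT1999, Ch. I §8 Prop. (8.2); Ch. III §2 Thm. (2.6)] -/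
theorem eventually_forall_inertiaDeg_eq_two_and_valued_toPlace_uniformizer :
    ∀ᶠ v : HeightOneSpectrum (𝓞 L⁺) in Filter.cofinite, ∀ w : PlacesOver L v, cc • w.1 = w.1 →
      w.1.asIdeal.inertiaDeg (𝓞 L⁺) = 2 ∧
        Valued.v (toPlace v w (HeckeCharacter.uniformizer L⁺ v : v.adicCompletion L⁺)) = WithZero.exp (-1 : ℤ) := by
  filter_upwards [eventually_forall_inertiaDeg_eq_two_of_smul_eq (F := L⁺) L cc (IsCMField.complexConj_ne_one L),
    eventually_forall_valued_toPlace_uniformizer (F := L⁺) L] with v h₁ h₂ w hw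
  exact ⟨h₁ w hw, h₂ w⟩

/-- **THE μ-LABELS OF TWO MEMBERS COINCIDE AT ALL BUT FINITELY MANY NON-SPLIT PLACES**: for conjugate symplectic `ψ, ψ' : C_L → S¹`
([Liu2021, Def. 4.1]), for all but finitely many finite places `v` of `L⁺` and every `w ∣ v` fixed by complex conjugation,
`localMu L (toHeckeCharacter L ψ) v = localMu L (toHeckeCharacter L ψ') v` — NO unramifiedness hypothesis: the exceptions lie below the
ramification of `L/L⁺` (§1) and of `toHeckeCharacter ψ`, `toHeckeCharacter ψ'` (`eventually_forall_placesOver_isUnramifiedAt`), and elsewhere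
`…InertRigidity.localMu_eq_localMu_of_inert_of_isUnramifiedAt` applies with the witness `ϖ_v`.  So across the displayed `hD3` family the
`μ`-conjunct of [Lem. D.1 (3)] AS PRINTED distinguishes two given members at only finitely many non-split places.
[cite: Liu2021, App. D §D.1 Step 2 (l. 5219), Lemma D.1 (3) (l. 5233); Def. 4.1] [cite: TateThesis1967, Lemma 3.2.1] -/
theorem eventually_localMu_eq_localMu (ψ ψ' : IdeleClassGroup L →ₜ* Circle) (hψ : IsConjugateSymplectic L ψ)
    (hψ' : IsConjugateSymplectic L ψ') :
    ∀ᶠ v : HeightOneSpectrum (𝓞 L⁺) in Filter.cofinite, ∀ w : PlacesOver L v, cc • w.1 = w.1 →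
      localMu L (toHeckeCharacter L ψ) v = localMu L (toHeckeCharacter L ψ') v := by
  filter_upwards [eventually_isUnramifiedIn (F := L⁺) L,
    eventually_forall_placesOver_isUnramifiedAt (F := L⁺) L (toHeckeCharacter L ψ),
    eventually_forall_placesOver_isUnramifiedAt (F := L⁺) L (toHeckeCharacter L ψ')] with v hv h₁ h₂ w hw
  exact LemD1IndexedNonVacuityInertRigidity.localMu_eq_localMu_of_inert_of_isUnramifiedAt L v ψ ψ' hψ hψ' w hw
    (HeckeCharacter.uniformizer L⁺ v) (valued_toPlace_uniformizer_of_isUnramifiedIn (F := L⁺) L v hv w) (h₁ w) (h₂ w)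

/-- **`Set.Finite` form: the NON-SPLIT places of `L⁺` at which the μ-labels of `ψ` and `ψ'` DIFFER are finite in number.**
[cite: Liu2021, App. D §D.1 Step 2 (l. 5219), Lemma D.1 (3) (l. 5233); Def. 4.1] [cite: TateThesis1967, Lemma 3.2.1] -/
theorem finite_nonsplit_localMu_ne (ψ ψ' : IdeleClassGroup L →ₜ* Circle) (hψ : IsConjugateSymplectic L ψ)
    (hψ' : IsConjugateSymplectic L ψ') :
    {v : HeightOneSpectrum (𝓞 L⁺) | ∃ w : PlacesOver L v, cc • w.1 = w.1 ∧
      localMu L (toHeckeCharacter L ψ) v ≠ localMu L (toHeckeCharacter L ψ') v}.Finite := by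
  refine (Filter.eventually_cofinite.1 (eventually_localMu_eq_localMu L ψ ψ' hψ hψ')).subset ?_
  rintro v ⟨w, hw, hne⟩
  exact fun hall => hne (hall w hw)

/-- **the closed form at all but finitely many non-split places**: for conjugate symplectic `ψ`, for all but finitely many `v` and every
`w ∣ v` fixed by complex conjugation, the rows' own `μ_v` IS the unramified sign character: `μ_v(x) = (−1)^{ord_w x_w}`.
[cite: Liu2021, App. D §D.1 Step 2 (l. 5219); Def. 4.1] [cite: TateThesis1967, Lemma 3.2.1] -/
theorem eventually_localMu_apply_eq_neg_one_zpow (ψ : IdeleClassGroup L →ₜ* Circle) (hψ : IsConjugateSymplectic L ψ) :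
    ∀ᶠ v : HeightOneSpectrum (𝓞 L⁺) in Filter.cofinite, ∀ w : PlacesOver L v, cc • w.1 = w.1 →
      ∀ x : (LocalRing L v)ˣ,
        localMu L (toHeckeCharacter L ψ) v x = (-1 : ℂˣ) ^ WithZero.log (Valued.v ((x : LocalRing L v) w)) := by
  filter_upwards [eventually_isUnramifiedIn (F := L⁺) L,
    eventually_forall_placesOver_isUnramifiedAt (F := L⁺) L (toHeckeCharacter L ψ)] with v hv h₁ w hw x
  exact LemD1IndexedNonVacuityInertRigidity.localMu_apply_eq_neg_one_zpow_of_inert_of_isUnramifiedAt L v ψ hψ w hw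
    (HeckeCharacter.uniformizer L⁺ v) (valued_toPlace_uniformizer_of_isUnramifiedIn (F := L⁺) L v hv w) (h₁ w) x

/-- **the value at the uniformiser, at all but finitely many non-split places**: `μ_v(ι_v ϖ_v) = −1` for the rows' own Step-2 slot (here only
the ramification of `L/L⁺` is excluded: `μ_v` satisfies the printed Step-2 clause at every place, tree `localMu_toLocalRing_eq_one_iff`).
[cite: Liu2021, App. D §D.1 Step 2 (l. 5219); Def. 4.1] [cite: NeukirchANT1999, Ch. III §2 Thm. (2.6)] -/
theorem eventually_localMu_apply_uniformizer_eq_neg_one (ψ : IdeleClassGroup L →ₜ* Circle) (hψ : IsConjugateSymplectic L ψ) :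
    ∀ᶠ v : HeightOneSpectrum (𝓞 L⁺) in Filter.cofinite, ∀ w : PlacesOver L v, cc • w.1 = w.1 →
      localMu L (toHeckeCharacter L ψ) v
          (Units.map (algebraMap (v.adicCompletion L⁺) (LocalRing L v)).toMonoidHom (HeckeCharacter.uniformizer L⁺ v)) = -1 :=
  (eventually_forall_stepTwo_apply_uniformizer_eq_neg_one (F := L⁺) L cc (complexConj_imagUnit L) (imagUnit_ne_zero L)).mono
    fun v hv w hw => hv w hw _
      (fun t => localMu_toLocalRing_eq_one_iff L (toHeckeCharacter L ψ) v ((isOscillatorChar_toHeckeCharacter_iff ψ).mpr hψ) t)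

variable (N : ℕ) (J : Matrix (Fin N) (Fin N) L) (hN : 2 ≤ N) (hJh : (J.map (IsCMField.complexConj L))ᵀ = J) (hJdet : J.det ≠ 0)

/-- **The packaged labels coincide at all but finitely many non-split places**: for conjugate symplectic `ψ, ψ'`, for all but finitely many
`v` and every `w ∣ v` fixed by complex conjugation, `LemD1OfPlace.muOf (localMu … ψ …) = LemD1OfPlace.muOf (localMu … ψ' …)` with the rows'
displayed side proofs — place by place outside a finite set, the `μ`-slot of the `hD3` family cannot distinguish the two members.
[cite: Liu2021, App. D §D.1 Step 2 (l. 5219), Lemma D.1 (3) (l. 5233)] [cite: TateThesis1967, Lemma 3.2.1] -/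
theorem eventually_muOf_localMu_eq (ψ ψ' : IdeleClassGroup L →ₜ* Circle) (hψ : IsConjugateSymplectic L ψ)
    (hψ' : IsConjugateSymplectic L ψ') :
    ∀ᶠ v : HeightOneSpectrum (𝓞 L⁺) in Filter.cofinite, ∀ w : PlacesOver L v, cc • w.1 = w.1 →
      LemD1OfPlace.muOf L v cc N J (complexConj_imagUnit L) (imagUnit_ne_zero L) hN hJh hJdet
          (localMu L (toHeckeCharacter L ψ) v)
          (fun x => norm_localMu L (toHeckeCharacter L ψ) v (isUnitary_toHeckeCharacter L ψ) x)
          (continuous_localMu L (toHeckeCharacter L ψ) v)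
          (fun t => localMu_toLocalRing_eq_one_iff L (toHeckeCharacter L ψ) v ((isOscillatorChar_toHeckeCharacter_iff ψ).mpr hψ) t) =
        LemD1OfPlace.muOf L v cc N J (complexConj_imagUnit L) (imagUnit_ne_zero L) hN hJh hJdet
          (localMu L (toHeckeCharacter L ψ') v)
          (fun x => norm_localMu L (toHeckeCharacter L ψ') v (isUnitary_toHeckeCharacter L ψ') x)
          (continuous_localMu L (toHeckeCharacter L ψ') v)
          (fun t => localMu_toLocalRing_eq_one_iff L (toHeckeCharacter L ψ') v
            ((isOscillatorChar_toHeckeCharacter_iff ψ').mpr hψ') t) :=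
  (eventually_localMu_eq_localMu L ψ ψ' hψ hψ').mono fun _ hv w hw => Subtype.ext (hv w hw)

end CM

end Literature.NumberTheory.Automorphic.Liu2021.LemD1IndexedNonVacuityInertCofinite

end
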